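/-
Copyright: lit-balaban Phase-2 proof seat p08 (gen 9).  Statement-level skeleton of a published paper; no proof claims beyond what
the kernel checks below.
-/
import Literature.MathematicalPhysics.QuantumFieldTheory.BalabanImbrieJaffe1984to88.BIJ88Decay213DkLocAllTori
import Literature.MathematicalPhysics.QuantumFieldTheory.BalabanImbrieJaffe1984to88.BIJ88Decay223CkAllTori
import Literature.MathematicalPhysics.QuantumFieldTheory.BalabanImbrieJaffe1984to88.BIJ85Prop12AllTori
import Literature.MathematicalPhysics.QuantumFieldTheory.BalabanImbrieJaffe1984to88.BIJ88CurlyDkLocGradTorus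
import Literature.MathematicalPhysics.QuantumFieldTheory.BalabanImbrieJaffe1984to88.BIJ88OpDecay213DkLocGradTorus

/-!
# `BalabanImbrieJaffe1984to88.BIJ88Sect2DkLocCkAllToriHolds` — T. Bałaban, J. Imbrie, A. Jaffe, *Effective action and cluster properties
of the abelian Higgs model*, Commun. Math. Phys. **114** (1988) 257–315 [BalabanImbrieJaffe1988], Sect. 2 pp. 261–262 [PDF 5–6]:
**(2.13), (2.23), (2.25) AND (2.26) FOR THE CONCRETE OBJECTS OF RECORD, OVER ALL TORI, HYPOTHESIS-FREE** — the all-tori theorems of this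
seat's `BIJ88Decay213DkLocAllTori` (r18's (2.12) kernel `dkLocKer`) and `BIJ88Decay223CkAllTori` (p08 g7's `CkE` and its localization)
with their one standing input, [6I] Proposition 1.2 by its tree name over the all-tori index, DISCHARGED by p19's
`BIJ85Prop12AllTori.prop12Printed_allTori` (from p37/p38's theorem `B5Prop12GHolds.prop12_famG_printed`): ONE set of constants for every
torus `T_η` with `P.d = d`, `P.L = L`, every scale `k ≤ m + K` (and, for `𝒟_{k,loc}`, every radius schedule) — *"independent of k, T_η"* —
assuming only `2 ≤ d`, `L` odd `> 1`, `a > 0`.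

statement-level skeleton of published theorems with citation tags; proofs where landed; nothing here is a claim about the Yang–Mills mass gap

PDF held: `paper:balaban1988-cmp114-bij-abelian-higgs-effective-action` (journal page = PDF page + 256), pp. 261–262 [PDF 5–6]; [6I] =
[Balaban1984PropagatorsI] Prop. 1.2 p. 35 *"independent of k, T_η"* (tree name `Balaban1983to89.B5.Prop12Printed`).

CITATION HEADER (lean-in-tree rule).  Part of the lit-balaban TYPED SKELETON (HOME `run/shared/lean/pub/lit-balaban/`), Phase-2 proof
seat p08 (gen 9), unit `lit-balaban-p08`; free-target protocol G.5-34(d), TAKING line HOME/STATUS.md 2026-08-21T22:14:14Z (item (G)) —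
the slot explicitly left to this seat by p16 g7 (seat INBOX 21:48:47Z (2): *"the hypothesis-free ALL-TORI forms of (2.13)/(2.23)/(2.25)/(2.26)
… are LEFT TO p08 g9"*).  WHAT IS REPRODUCED = SKELETON rows **C2.Eq2.13**, **C2.Eq2.23**, **C2.Eq2.25**, **C2.Eq2.26** (owner r18,
referee ref-5), kind «model instance», hypothesis-free all-tori shape (typing note G-C1-07).  Decls used BY NAME (nothing restated): this
seat's `BIJ88Decay213DkLocAllTori.decayDkLoc_allTori_of_prop12Printed` / `diag_dkLoc_allTori_of_prop12Printed` /
`opDecay213_dkLoc_allTori_of_prop12Printed` / `opDecay213_dkLoc_typed_allTori_of_prop12Printed`,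
`BIJ88Decay223CkAllTori.decay223_Ck_allTori_of_prop12Printed` / `decayFar223_Ck_allTori_of_prop12Printed` /
`decay223_CkLoc_allTori_of_prop12Printed` / `close226_allTori_of_prop12Printed`; p19's `BIJ85Prop12AllTori.prop12Printed_allTori`.
Siblings (same pattern, other rows): p16's `BIJ85Sect72AllToriHolds` ((7.2.2), (7.2.4), 𝒟_k, (2.16)–(2.19), σ_k).

THE PRINTED TEXT (verbatim).  p. 261: *"|(𝒟_{k,loc}f)(b)| ≦ ce^{−c dist(suppt f,b)}‖f‖_∞ (2.13)"*; p. 262: *"|C_k(x,b′)| ≦ ce^{−c dist(x,b′)},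
dist(x,b′) > c. (2.23) … Define C_{k,loc}(x,b′) = ζ′_k(x,b′)C_k(x,b′). (2.25) Then C_{k,loc} also satisfies (2.23), and |C_{k,loc}(x,b′) −
C_k(x,b′)| ≦ e^{−cr(e_k)}e^{−c dist(x,b′)}. (2.26)"*; [6I] p. 35: constants *"independent of k, T_η"*.

WHAT IS PROVED (0 `sorry`, standard axioms; theorems only — proof lane; each a one-line discharge of the sibling's `h12`):
* §1 `𝒟_{k,loc}`: **`decayDkLoc_allTori`** (ONE `(R₀, c₀, δ′)`: `|𝒟_{k,loc}(b,b″)| ≤ c₀e^{−δ′dist_k(b,b″)}` beyond `R₀`, every torus, `k ≤ m + K`,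
  schedule `ρ`), `diag_dkLoc_allTori` (ONE `C`: `|𝒟_{k,loc}(b,b″)| ≤ CΣ_{j<k}(L^{k−j})^{d−2}` everywhere), **`opDecay213_dkLoc_allTori`** ((2.13) AS
  PRINTED with the `η^d`-weighted action, ONE `(c₁, δ′)`, all `b`), `opDecay213_dkLoc_typed_allTori` (r18's one-letter `OpDecay`, ONE `(κ, c)`).
* §2 `C_k`, `C_{k,loc}`: **`decay223_Ck_allTori`** ((2.23), ONE `(R₀, c₀, δ′)`), `decayFar223_Ck_allTori` (r18's `DecayFar`, ONE `(κ, c)`),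
  **`decay223_CkLoc_allTori`** ((2.25): the same for `C_{k,loc}`, every radius `r`), **`close226_allTori`** ((2.26), ONE `(R₀, c₀, δ′)`, every
  `r ≥ 4R₀`).
* §3 (v1.1) the DERIVATIVE clause of (2.13) (*"and similarly for derivatives of 𝒟_{k,loc}"*) over all tori, hypothesis-free, for schedules
  with `ρ_j ≥ ρ₀ > 0`: **`gradDkLoc_allTori`** (kernel form beyond a threshold: ONE `(R₀, c₁, δ′)` with `L^k|Δ_λ𝒟_{k,loc}(⟨x,μ⟩,b″)| ≤
  c₁e^{−δ′dist_k}`; this seat's `BIJ88CurlyDkLocGradTorus.gradDkLoc_allTori_of_prop12Printed`) and **`opDecay213_gradDkLoc_allTori`** (operator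
  form, all arguments: ONE `(c₂, δ′)` with `L^k|Δ_λ(𝒟_{k,loc}f)(⟨x,μ⟩)| ≤ c₂e^{−δ′dist_k(suppt f,⟨x,μ⟩)}‖f‖_∞`;
  `BIJ88OpDecay213DkLocGradTorus.opDecay213_gradDkLoc_allTori_of_prop12Printed`).
HONEST SCOPE.  Pure discharge: the analysis is in the cited sibling files and their inputs (explicit constants there); the readings (the
`η^d`-weighted action of (2.13), `dist(x,b′)` = p09's `distEU`, (2.26)'s `e^{−cr(e_k)}` = `c₀e^{−(δ′/8)r}`) are those files'.  Remaining
hypotheses: NONE beyond `2 ≤ d`, `L` odd `> 1`, `a > 0` (the mass parameter of `Δ_a`).  The Hölder clause of (2.13) is not in this file (v1.1 adds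
the derivative clause, §3; its constants depend on the lower bound `ρ₀` of the radii).  `U = 1`, real abelian fields, torus, standing range.  No `def`, no new named fact, nothing restated; NOT summit progress.  Unit
`lit-balaban-p08` (literature-prover-lit-balaban-p08-g9-0), 2026-08-21.
-/

open scoped BigOperators RealInnerProductSpace

namespace Literature.MathematicalPhysics.QuantumFieldTheory.BalabanImbrieJaffe1984to88.BIJ88Sect2DkLocCkAllToriHolds

open Balaban1983to89 hiding Site Plaq
open Balaban1983to89.LatticeFieldCalculus
open BIJ85AxialPropagator411 BIJ85Prop521Torus BIJ85Sigma421Torus BIJ85Prop522Torus BIJ85Sigma422Eta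
open BIJ85Sect7Statements BIJ85Ineq722Torus
open BIJ85Ineq722DeltaA (deltaAData)
open BIJ85Ineq722ProofPart2 (settingOf)
open BIJ88Sect2Statements (applyK supNorm suppDist OpDecay DecayFar Close loc)
open BIJ88Cutoffs21 (cutoff)
open BIJ88Eq220Torus (CkE)
open BIJ85Prop12AllTori (prop12Printed_allTori)
open BIJ88CurlyDkLocTorus BIJ88Decay213DkLocAllTori BIJ88Decay223CkAllTori
open BIJ88CurlyDkLocGradTorus (gradDkLoc_allTori_of_prop12Printed)
open BIJ88OpDecay213DkLocGradTorus (opDecay213_gradDkLoc_allTori_of_prop12Printed)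
-- inside this namespace the bare `Site`/`Plaq` are the `ℤ^d` carriers of the QFT root; the torus ones are renamed:
open Balaban1983to89 renaming Site → TSite, Plaq → TPlaq

noncomputable section

/-! ## §1  `𝒟_{k,loc}`: row C2.Eq2.13 over all tori, hypothesis-free -/

section DkLoc

/-- **THE CONCRETE `𝒟_{k,loc}` KERNEL DECAYS WITH ONE `(R₀, c₀, δ′)` ON EVERY TORUS, HYPOTHESIS-FREE** (`2 ≤ d`, `L` odd `> 1`, `a > 0`): for
every torus (`P.d = d`, `P.L = L`), every `k ≤ m + K`, every radius schedule `ρ` and all `b, b″` with `dist_k(b,b″) ≥ R₀`,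
`|𝒟_{k,loc}(b,b″)| ≤ c₀e^{−δ′dist_k(b,b″)}` — `decayDkLoc_allTori_of_prop12Printed` with [6I] Prop. 1.2 supplied by p19's `prop12Printed_allTori`.
[cite: BalabanImbrieJaffe1988, (2.13) p.261] -/
theorem decayDkLoc_allTori {d L : ℕ} (hd : 2 ≤ d) (hL : Odd L ∧ 1 < L) {a : ℝ} (ha : 0 < a) :
    ∃ R₀ c₀ δ' : ℝ, 0 < δ' ∧ 0 ≤ c₀ ∧ ∀ (P : Params) (_ : P.d = d) (_ : P.L = L) (k : ℕ) (_ : k ≤ P.m + P.K) (ρ : ℕ → ℝ)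
      (b b'' : PBond P 0), R₀ ≤ kdist (P := P) k b b'' →
        |dkLocKer (P := P) ((P.eta k) ^ P.d) ((P.L : ℝ) ^ k) ρ k b b''| ≤ c₀ * Real.exp (-δ' * kdist (P := P) k b b'') :=
  decayDkLoc_allTori_of_prop12Printed hd hL ha (prop12Printed_allTori d L ha)

/-- **the uniform near-diagonal bound over all tori, hypothesis-free**: ONE `C ≥ 0` with `|𝒟_{k,loc}(b,b″)| ≤ CΣ_{j<k}(L^{k−j})^{d−2}` for every
torus (`P.d = d`, `P.L = L`), every `k ≤ m + K`, every schedule and all `b, b″`. [cite: BalabanImbrieJaffe1988, (2.12)-(2.13) p.261] -/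
theorem diag_dkLoc_allTori {d L : ℕ} (hd : 2 ≤ d) (hL : Odd L ∧ 1 < L) {a : ℝ} (ha : 0 < a) :
    ∃ C : ℝ, 0 ≤ C ∧ ∀ (P : Params) (_ : P.d = d) (_ : P.L = L) (k : ℕ) (_ : k ≤ P.m + P.K) (ρ : ℕ → ℝ) (b b'' : PBond P 0),
        |dkLocKer (P := P) ((P.eta k) ^ P.d) ((P.L : ℝ) ^ k) ρ k b b''| ≤
          C * ∑ j ∈ Finset.range k, ((P.L : ℝ) ^ (k - j)) ^ (P.d - 2) :=
  diag_dkLoc_allTori_of_prop12Printed hd hL ha (prop12Printed_allTori d L ha)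

/-- **(2.13) AS PRINTED FOR THE CONCRETE `𝒟_{k,loc}`, OVER ALL TORI, HYPOTHESIS-FREE** (`2 ≤ d`, `L` odd `> 1`, `a > 0`): ONE `(c₁, δ′)`,
`δ′ > 0`, with `|(𝒟_{k,loc}f)(b)| ≤ c₁e^{−δ′dist_k(suppt f,b)}‖f‖_∞` (the `η^d`-weighted action of `BIJ88OpDecay213DkLocTorus`) for EVERY torus
(`P.d = d`, `P.L = L`), every `k ≤ m + K`, every schedule, every `f` and ALL `b` — *"c … independent of k, T_η"*.
[cite: BalabanImbrieJaffe1988, (2.13) p.261] -/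
theorem opDecay213_dkLoc_allTori {d L : ℕ} (hd : 2 ≤ d) (hL : Odd L ∧ 1 < L) {a : ℝ} (ha : 0 < a) :
    ∃ c₁ δ' : ℝ, 0 < δ' ∧ 0 ≤ c₁ ∧ ∀ (P : Params) (_ : P.d = d) (_ : P.L = L) (k : ℕ) (_ : k ≤ P.m + P.K) (ρ : ℕ → ℝ)
      (f : PBond P 0 → ℝ) (b : PBond P 0),
        |applyK (fun b b'' => (P.eta k) ^ P.d * dkLocKer (P := P) ((P.eta k) ^ P.d) ((P.L : ℝ) ^ k) ρ k b b'') f b| ≤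
          c₁ * Real.exp (-δ' * suppDist (fun a b => kdist (P := P) k a b) f b) * supNorm f :=
  opDecay213_dkLoc_allTori_of_prop12Printed hd hL ha (prop12Printed_allTori d L ha)

/-- **(2.13) IN r18's ONE-LETTER SHAPE OVER ALL TORI, HYPOTHESIS-FREE**: ONE `(κ, c)`, `0 < κ`, `0 < c`, with
`OpDecay (κ·dist_k) (η_k^d𝒟_{k,loc}) c` on every torus (`P.d = d`, `P.L = L`), every `k ≤ m + K`, every schedule.
[cite: BalabanImbrieJaffe1988, (2.13) p.261] -/
theorem opDecay213_dkLoc_typed_allTori {d L : ℕ} (hd : 2 ≤ d) (hL : Odd L ∧ 1 < L) {a : ℝ} (ha : 0 < a) :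
    ∃ κ c : ℝ, 0 < κ ∧ 0 < c ∧ ∀ (P : Params) (_ : P.d = d) (_ : P.L = L) (k : ℕ) (_ : k ≤ P.m + P.K) (ρ : ℕ → ℝ),
      OpDecay (fun a b => κ * kdist (P := P) k a b)
        (fun b b'' => (P.eta k) ^ P.d * dkLocKer (P := P) ((P.eta k) ^ P.d) ((P.L : ℝ) ^ k) ρ k b b'') c :=
  opDecay213_dkLoc_typed_allTori_of_prop12Printed hd hL ha (prop12Printed_allTori d L ha)

end DkLoc

/-! ## §2  `C_k` and `C_{k,loc}`: rows C2.Eq2.23 / 2.25 / 2.26 over all tori, hypothesis-free -/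

section Ck

/-- **(2.23) FOR THE `C_k` OF RECORD OVER ALL TORI, HYPOTHESIS-FREE** (`2 ≤ d`, `L` odd `> 1`, `a > 0`): ONE `(R₀, c₀, δ′)`, `δ′ > 0`, with
`|C_k(x,b′)| ≤ c₀e^{−δ′dist(x,b′)}` for `dist(x,b′) ≥ R₀` on EVERY torus (`P.d = d`, `P.L = L`) and every `k ≤ m + K` — *"a uniform bound …
(2.23)"*, constants *"independent of k, T_η"*. [cite: BalabanImbrieJaffe1988, (2.23) p.262] -/
theorem decay223_Ck_allTori {d L : ℕ} (hd : 2 ≤ d) (hL : Odd L ∧ 1 < L) {a : ℝ} (ha : 0 < a) :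
    ∃ R₀ c₀ δ' : ℝ, 0 < δ' ∧ 0 ≤ c₀ ∧ ∀ (P : Params) (_ : P.d = d) (_ : P.L = L) (hdP : 2 ≤ P.d) (k : ℕ) (_ : k ≤ P.m + P.K)
      (x : TSite P 0) (b' : PBond P k), R₀ ≤ distEU P k x b'.src →
        |CkE P hdP ((P.eta k) ^ P.d) ((P.L : ℝ) ^ k) k (toEj P k (Pi.single b' 1)) x| ≤
          c₀ * Real.exp (-δ' * distEU P k x b'.src) :=
  decay223_Ck_allTori_of_prop12Printed hd hL ha (prop12Printed_allTori d L ha)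

/-- **(2.23) in r18's one-letter shape over all tori, hypothesis-free**: ONE `(κ, c)` with `DecayFar (κ·dist) C_k c` on every torus
(`P.d = d`, `P.L = L`) and every `k ≤ m + K`. [cite: BalabanImbrieJaffe1988, (2.23) p.262] -/
theorem decayFar223_Ck_allTori {d L : ℕ} (hd : 2 ≤ d) (hL : Odd L ∧ 1 < L) {a : ℝ} (ha : 0 < a) :
    ∃ κ c : ℝ, 0 < κ ∧ 0 < c ∧ ∀ (P : Params) (_ : P.d = d) (_ : P.L = L) (hdP : 2 ≤ P.d) (k : ℕ) (_ : k ≤ P.m + P.K),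
      DecayFar (fun (x : TSite P 0) (b' : PBond P k) => κ * distEU P k x b'.src)
        (fun x b' => CkE P hdP ((P.eta k) ^ P.d) ((P.L : ℝ) ^ k) k (toEj P k (Pi.single b' 1)) x) c :=
  decayFar223_Ck_allTori_of_prop12Printed hd hL ha (prop12Printed_allTori d L ha)

/-- **(2.25): `C_{k,loc} = ζ′_kC_k` ALSO SATISFIES (2.23), OVER ALL TORI, HYPOTHESIS-FREE** — the SAME `(R₀, c₀, δ′)` shape for the localized
kernel at every radius `r`, every torus (`P.d = d`, `P.L = L`), every `k ≤ m + K`. [cite: BalabanImbrieJaffe1988, (2.25) p.262] -/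
theorem decay223_CkLoc_allTori {d L : ℕ} (hd : 2 ≤ d) (hL : Odd L ∧ 1 < L) {a : ℝ} (ha : 0 < a) :
    ∃ R₀ c₀ δ' : ℝ, 0 < δ' ∧ 0 ≤ c₀ ∧ ∀ (P : Params) (_ : P.d = d) (_ : P.L = L) (hdP : 2 ≤ P.d) (k : ℕ) (_ : k ≤ P.m + P.K)
      (r : ℝ) (x : TSite P 0) (b' : PBond P k), R₀ ≤ distEU P k x b'.src →
        |loc (cutoff (r / 4) (r / 2) fun (x : TSite P 0) (b' : PBond P k) => distEU P k x b'.src)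
            (fun x b' => CkE P hdP ((P.eta k) ^ P.d) ((P.L : ℝ) ^ k) k (toEj P k (Pi.single b' 1)) x) x b'| ≤
          c₀ * Real.exp (-δ' * distEU P k x b'.src) :=
  decay223_CkLoc_allTori_of_prop12Printed hd hL ha (prop12Printed_allTori d L ha)

/-- **(2.26) OVER ALL TORI, HYPOTHESIS-FREE** (`2 ≤ d`, `L` odd `> 1`, `a > 0`): ONE `(R₀, c₀, δ′)`, `δ′ > 0`, with
`Close dist C_{k,loc} C_k (c₀e^{−(δ′/2)(r/4)}) (δ′/2)` — `|C_{k,loc}(x,b′) − C_k(x,b′)| ≤ c₀e^{−(δ′/8)r}e^{−(δ′/2)dist(x,b′)}` — on every torus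
(`P.d = d`, `P.L = L`), every `k ≤ m + K`, every radius `r ≥ 4R₀`. [cite: BalabanImbrieJaffe1988, (2.26) p.262] -/
theorem close226_allTori {d L : ℕ} (hd : 2 ≤ d) (hL : Odd L ∧ 1 < L) {a : ℝ} (ha : 0 < a) :
    ∃ R₀ c₀ δ' : ℝ, 0 < δ' ∧ 0 ≤ c₀ ∧ ∀ (P : Params) (_ : P.d = d) (_ : P.L = L) (hdP : 2 ≤ P.d) (k : ℕ) (_ : k ≤ P.m + P.K)
      (r : ℝ), 4 * R₀ ≤ r →
      Close (fun (x : TSite P 0) (b' : PBond P k) => distEU P k x b'.src)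
        (loc (cutoff (r / 4) (r / 2) fun (x : TSite P 0) (b' : PBond P k) => distEU P k x b'.src)
          (fun x b' => CkE P hdP ((P.eta k) ^ P.d) ((P.L : ℝ) ^ k) k (toEj P k (Pi.single b' 1)) x))
        (fun x b' => CkE P hdP ((P.eta k) ^ P.d) ((P.L : ℝ) ^ k) k (toEj P k (Pi.single b' 1)) x)
        (c₀ * Real.exp (-(δ' / 2) * (r / 4))) (δ' / 2) :=
  close226_allTori_of_prop12Printed hd hL ha (prop12Printed_allTori d L ha)

end Ck

/-! ## §3  (v1.1) The derivative clause of (2.13) over all tori, hypothesis-free -/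

section Grad

/-- **THE `η`-DERIVATIVE OF THE CONCRETE `𝒟_{k,loc}` KERNEL OVER ALL TORI, HYPOTHESIS-FREE** (`2 ≤ d`, `L` odd `> 1`, `a > 0`, radii
`ρ_j ≥ ρ₀ > 0`): ONE `(R₀, c₁, δ′)` with `L^k·|𝒟_{k,loc}(⟨x+e_λ,μ⟩,b″) − 𝒟_{k,loc}(⟨x,μ⟩,b″)| ≤ c₁e^{−δ′dist_k(⟨x,μ⟩,b″)}` beyond `R₀` for every
torus (`P.d = d`, `P.L = L`), every `k ≤ m + K`, every admissible schedule — *"similarly for derivatives of 𝒟_{k,loc}"*.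
[cite: BalabanImbrieJaffe1988, (2.13) p.261] -/
theorem gradDkLoc_allTori {d L : ℕ} (hd : 2 ≤ d) (hL : Odd L ∧ 1 < L) {a : ℝ} (ha : 0 < a) {ρ₀ : ℝ} (hρ₀ : 0 < ρ₀) :
    ∃ R₀ c₁ δ' : ℝ, 0 < δ' ∧ 0 ≤ c₁ ∧ ∀ (P : Params) (_ : P.d = d) (_ : P.L = L) (k : ℕ) (_ : k ≤ P.m + P.K) (ρ : ℕ → ℝ)
      (_ : ∀ j < k, ρ₀ ≤ ρ j) (x : TSite P 0) (μ lam : Fin P.d) (b'' : PBond P 0), R₀ ≤ kdist (P := P) k ⟨x, μ⟩ b'' →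
        (P.L : ℝ) ^ k * |dkLocKer (P := P) ((P.eta k) ^ P.d) ((P.L : ℝ) ^ k) ρ k ⟨x.shift lam, μ⟩ b'' -
            dkLocKer (P := P) ((P.eta k) ^ P.d) ((P.L : ℝ) ^ k) ρ k ⟨x, μ⟩ b''| ≤
          c₁ * Real.exp (-δ' * kdist (P := P) k ⟨x, μ⟩ b'') :=
  gradDkLoc_allTori_of_prop12Printed hd hL ha (prop12Printed_allTori d L ha) hρ₀

/-- **THE DERIVATIVE CLAUSE OF (2.13) IN OPERATOR FORM OVER ALL TORI, HYPOTHESIS-FREE** (`2 ≤ d`, `L` odd `> 1`, `a > 0`, radii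
`ρ_j ≥ ρ₀ > 0`): ONE `(c₂, δ′)` with `L^k·|(𝒟_{k,loc}f)(⟨x+e_λ,μ⟩) − (𝒟_{k,loc}f)(⟨x,μ⟩)| ≤ c₂e^{−δ′dist_k(suppt f,⟨x,μ⟩)}‖f‖_∞` (the
`η^d`-weighted action) for every torus (`P.d = d`, `P.L = L`), every `k ≤ m + K`, every admissible schedule, every `f` and ALL `x, μ, λ`.
[cite: BalabanImbrieJaffe1988, (2.13) p.261] -/
theorem opDecay213_gradDkLoc_allTori {d L : ℕ} (hd : 2 ≤ d) (hL : Odd L ∧ 1 < L) {a : ℝ} (ha : 0 < a) {ρ₀ : ℝ} (hρ₀ : 0 < ρ₀) :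
    ∃ c₂ δ' : ℝ, 0 < δ' ∧ 0 ≤ c₂ ∧ ∀ (P : Params) (_ : P.d = d) (_ : P.L = L) (k : ℕ) (_ : k ≤ P.m + P.K) (ρ : ℕ → ℝ)
      (_ : ∀ j < k, ρ₀ ≤ ρ j) (f : PBond P 0 → ℝ) (x : TSite P 0) (μ lam : Fin P.d),
        (P.L : ℝ) ^ k * |applyK (fun b b'' => (P.eta k) ^ P.d * dkLocKer (P := P) ((P.eta k) ^ P.d) ((P.L : ℝ) ^ k) ρ k b b'') f
              ⟨x.shift lam, μ⟩ -
            applyK (fun b b'' => (P.eta k) ^ P.d * dkLocKer (P := P) ((P.eta k) ^ P.d) ((P.L : ℝ) ^ k) ρ k b b'') f ⟨x, μ⟩| ≤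
          c₂ * Real.exp (-δ' * suppDist (fun a b => kdist (P := P) k a b) f ⟨x, μ⟩) * supNorm f :=
  opDecay213_gradDkLoc_allTori_of_prop12Printed hd hL ha (prop12Printed_allTori d L ha) hρ₀

end Grad

end

end Literature.MathematicalPhysics.QuantumFieldTheory.BalabanImbrieJaffe1984to88.BIJ88Sect2DkLocCkAllToriHolds
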